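import Summits.ValiantsHypothesis.ValiantsHypothesis.Theorems.FifoMatchingNNDivisionHardLocatedFaceExposure
import Summits.ValiantsHypothesis.ValiantsHypothesis.Theorems.FifoMatchingXcDivisionChamberCertificate

/-!
# Exposed-fibre law `E♭` and its fixed points (val-idea-40 g3, b139 WAVE-5 seat W5-P2, crux `stmt-ValiantsHypothesis-21181`)

Located data at the contraction face `F_β` of `COR(K_n)` = the FIBRES of the passenger `Q` over the
`𝒩_β`-exposed vertices of its shadow `π_{W_β^⊥} Q` (`W_β` = span of the block-constant vertices,
`N_{COR}(F_β) ⊆ W_β^⊥`).  The landed engine (`…Theorems.FifoMatching.LocatedFaceExposure`) needs exactly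
ONE such fibre to be `J`-degenerate.  Hence the certificate class

* `ExposedFibreBlind β q`  (E♭):  ∃ ONE admissible direction `c` (`c ⊥ W_β`, `c < 0` on every non-block-constant
  vertex) whose maximisers among the generators differ by multiples of `J`;

with the strict hierarchy  `BlockBlind` (E, line rev 11) ⊊ `FaceBlockBlind` (E♯, val-idea-41 g3, all iterated-argmax
sets = all block-constant EDGE directions) ⊊ E♭, separated by BUDGETED members:  `Π*` ∈ E♯ ∖ E (41 g3) and the
McCORMICK body `M_n` ∈ E♭ ∖ E♯ (§2: `[0, 𝟙_B𝟙_Bᵀ]` is a block-constant edge of `M_n` for every block `B`, yet the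
exposed fibre over `F_β` is ONE vertex).  §3 places the boundary: the metric body `MET^{COR}` (like `Z_full` and
`COR` itself) is a FIXED POINT of the `C₀^β`-first located read — its `C₀^β`-face lies inside `W_β` and reads onto
`MET^{COR}` one scale down (`met_contract`, proved) — so E, E♯ and every `C₀^β`-perturbative located certificate are
vacuous on contraction-closed species; but the FAR chambers of the admissible cone bite: the HYPERMETRIC (pentagonal)
direction exposes a ONE-POINT fibre of `MET` (`pentagonal_le` / `pentagonal_eq`, proved: `max_{MET₅} P_σ = 2/3`
uniquely at the anti-cut `⅔𝟙 − ⅓δ(A)`), whence `xc(COR(K_n) + MET_{n+1}) ≥ 1.5^{⌊n/2⌋} − 1` by two exact cuts and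
no anchoring (§3b).  For zonotopes far chambers add nothing: `E♭ = E♯` there (§4).

Statements are `def … : Prop` (kernel food for the pen); the cell-level identities behind §2, the contraction lemma
and the pentagonal certificate behind §3 are proved.  21181 OPEN; COR-VIRTUAL OPEN; VP ≠ VNP NOT proved.
-/

set_option autoImplicit false
set_option linter.dupNamespace false
set_option linter.unusedVariables false

noncomputable section
open Matrix Finset
open scoped Pointwise

namespace Summit.ValiantsHypothesis.ValiantsHypothesis.Cruxes.NNDivisionHard.ExposedFibre40

open Literature.Barriers.PneNP (HasEFOfSize)
open Literature.Combinatorics.Optimization (corPolytopeGraph corVec)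
open Summit.ValiantsHypothesis.ValiantsHypothesis.Theorems.FifoMatching.LocatedFaceExposure
open Summit.ValiantsHypothesis.ValiantsHypothesis.Theorems.FifoMatching.XcDivision

variable {n m : ℕ}

/-! ## KERNEL STATUS (rev 3, val-idea-40 g3, 2026-08-28T21:16Z) — `lean check` rc 0, 0 sorries, 0 warnings
PROVED here (all `theorem …_holds : <Prop>` for the `def <Prop> : Prop` items of this file):
`exposedFibreRung_holds`, `exposedFibreDecided_holds` (§1b, the E♭ one-cut rung + count; critic price P-P2d),
`mcCormickLocatedDecided_holds` (§2b: `HasEFOfSize (COR(K_n) + M_n) r → 3^m ≤ (r+1)·2^m`, blocks ≥ 2; P-P2e),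
`metFaceBlockConst_holds` (§3a fixed point), `metLocatedDecided_holds` (§3c: `HasEFOfSize (COR(K_n) + MET^{COR}_{n+1}) r →
3^m ≤ (r+1)·2^m`, blocks ≥ 2; P-P2e).  Still statements only: `BlockBlind_sub_ExposedFibreBlind`, `McCormickExposedFibreBlind`,
`McCormickBlockEdge`, `MetFixedPoint`, `MetContractionClosed`, `MetExposedFibreBlind`, `ZonoExposedFibreBlindIff`,
`ResidualHasFatFibres` (N14). -/

/-! ## §0 Currency (verbatim shapes of the line / of 41 g3's `FaceBlind41`) -/

/-- a `0/1` vector constant on the blocks of `β` (these index the vertices of the contraction face `F_β ≅ COR(K_m)`). -/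
def BlockConst (β : Fin n → Fin m) (b : Fin n → Bool) : Prop := ∀ p q, β p = β q → b p = b q

/-- (line, verbatim) a symmetric, `β`-block-constant matrix direction — the elements of `W_β`. -/
def BlockConstSymGen (β : Fin n → Fin m) (g : Fin n × Fin n → ℝ) : Prop :=
  (∀ p p', g (p, p') = g (p', p)) ∧ ∀ p p' p'' p''', β p = β p'' → β p' = β p''' → g (p, p') = g (p'', p''')

/-- the all-ones direction `J`. -/
def Jdir (n : ℕ) : Fin n × Fin n → ℝ := fun _ => 1

/-- **ADMISSIBLE (located) direction** for the contraction face `F_β`: a linear functional that vanishes on the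
block-constant vertices of `COR(K_n)` and is strictly negative on every other vertex — so `COR(K_n) ∩ {c = 0} = F_β`.
`C₀^β` (the engine's `blockDir`) is one (`admissible_blockDir`); so is `C₀^β + ε d` for every `d ⊥ W_β`, `ε` small. -/
def Admissible (β : Fin n → Fin m) (c : Fin n × Fin n → ℝ) : Prop :=
  (∀ b, BlockConst β b → c ⬝ᵥ corVec (⊤ : SimpleGraph (Fin n)) b = 0) ∧
  (∀ b, ¬ BlockConst β b → c ⬝ᵥ corVec (⊤ : SimpleGraph (Fin n)) b < 0)

/-- the engine's direction `C₀^β` is admissible (from the landed G1 lemmas). -/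
theorem admissible_blockDir (β : Fin n → Fin m) : ∃ c : Fin n × Fin n → ℝ, Admissible β c := by
  obtain ⟨B, hB⟩ := exists_blockDir (n := n) (m := m) β
  refine ⟨B, fun b hb => dot_eq_zero_of_blockConst β hB hb, fun b hb => ?_⟩
  rcases (blockDir_dot_corVec_le β hB b).lt_or_eq with h | h
  · exact h
  · exact absurd (blockConst_of_dot_eq_zero β hB h) hb

/-! ## §1 The class `E♭` and the one-cut rung -/

/-- **CLASS E♭ — EXPOSED-FIBRE-BLIND.**  Some admissible direction `c` whose maximisers among the generators
`q j` pairwise differ by multiples of `J`: the fibre of `conv q` over ONE `𝒩_β`-exposed vertex of the shadow is a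
`J`-segment.  (E asks this of ALL block-constant differences, E♯ of all block-constant EDGE directions.) -/
def ExposedFibreBlind (β : Fin n → Fin m) {J : Type} (q : J → (Fin n × Fin n → ℝ)) : Prop :=
  ∃ c : Fin n × Fin n → ℝ, Admissible β c ∧
    ∀ j j', (∀ k, c ⬝ᵥ q k ≤ c ⬝ᵥ q j) → (∀ k, c ⬝ᵥ q k ≤ c ⬝ᵥ q j') → ∃ α : ℝ, q j - q j' = α • Jdir n

/-- **ONE-CUT RUNG** (PROVED below, `exposedFibreRung_holds`: `face_add_face₁` ONCE with the admissible `c` —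
`COR ∩ {c = 0} = F_β` by `XcDivision.convexHull_range_inter_eq` + `Admissible` —, then `funLeft_image_cor_blockFace`,
`convexHull_collinear_pair`; no `blockRead_iterate`).  `m` free, as in the landed rung. -/
def ExposedFibreRung : Prop :=
  ∀ (n m : ℕ) (β : Fin n → Fin m) (ρ : Fin m → Fin n), (∀ t, β (ρ t) = t) →
    ∀ (K : ℕ) (q : Fin (K + 1) → (Fin n × Fin n → ℝ)) (r : ℕ),
      ExposedFibreBlind β q →
      HasEFOfSize (corPolytopeGraph (⊤ : SimpleGraph (Fin n)) + convexHull ℝ (Set.range q)) r →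
        ∃ q' : Fin 2 → (Fin m × Fin m → ℝ),
          HasEFOfSize (corPolytopeGraph (⊤ : SimpleGraph (Fin m)) + convexHull ℝ (Set.range q')) r

/-- … hence (PROP A at `K + 1 = 2`, `corPolytopeGraph_top_add_hull_three_pow_le`) the count `3^m ≤ (r+1)·2^(m+1)`
for every `E♭`-certified block map with `m` blocks — at `m = lvl n + 1` the line's rate, at `m = 2(log₂ n + c)^c + 4`
already the route's rate `T c n < r`. -/
def ExposedFibreDecided : Prop :=
  ∀ (n m : ℕ) (β : Fin n → Fin m) (ρ : Fin m → Fin n), (∀ t, β (ρ t) = t) →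
    ∀ (K : ℕ) (q : Fin (K + 1) → (Fin n × Fin n → ℝ)) (r : ℕ),
      ExposedFibreBlind β q →
      HasEFOfSize (corPolytopeGraph (⊤ : SimpleGraph (Fin n)) + convexHull ℝ (Set.range q)) r →
        3 ^ m ≤ (r + 1) * 2 ^ (m + 1)

/-- `E ⊆ E♭` (kernel food: take `c := C₀^β + ε d` with `d ⊥ W_β` generic — `DimensionRung40.exists_generic_comb` —
so that all maximiser differences are block-constant, then apply the `E`-hypothesis).  `E♯ ⊆ E♭` is the same
argument applied to the iterated-argmax set the engine visits. -/
def BlockBlind_sub_ExposedFibreBlind : Prop :=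
  ∀ (n m : ℕ) (β : Fin n → Fin m) (K : ℕ) (q : Fin (K + 1) → (Fin n × Fin n → ℝ)),
    (∀ j j', BlockConstSymGen β (q j - q j') → ∃ α : ℝ, q j - q j' = α • Jdir n) → ExposedFibreBlind β q


/-! ### §1b The one-cut rung — PROVED (critic price P-P2d) -/

/-- for an admissible `c`: `c ⬝ᵥ corVec b = 0 ↔ b` is block-constant. -/
theorem Admissible.dot_eq_zero_iff {β : Fin n → Fin m} {c : Fin n × Fin n → ℝ} (hc : Admissible β c)
    (b : Fin n → Bool) : c ⬝ᵥ corVec (⊤ : SimpleGraph (Fin n)) b = 0 ↔ BlockConst β b := by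
  constructor
  · intro h
    by_contra hb
    exact (hc.2 b hb).ne h
  · exact hc.1 b

/-- an admissible `c` is valid on the vertices of `COR(K_n)` with maximum `0`. -/
theorem Admissible.dot_le {β : Fin n → Fin m} {c : Fin n × Fin n → ℝ} (hc : Admissible β c)
    (b : Fin n → Bool) : c ⬝ᵥ corVec (⊤ : SimpleGraph (Fin n)) b ≤ 0 := by
  by_cases hb : BlockConst β b
  · exact (hc.1 b hb).le
  · exact (hc.2 b hb).le

/-- the `c`-face of `COR(K_n)` IS the contraction face `F_β` (as cut by the engine's `C₀^β`). -/
theorem Admissible.face_eq {β : Fin n → Fin m} {c : Fin n × Fin n → ℝ} (hc : Admissible β c)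
    {B : Fin n × Fin n → ℝ}
    (hB : ∀ x : Fin n × Fin n → ℝ,
      B ⬝ᵥ x = ∑ p : Fin n, ∑ q : Fin n, if β q = β p ∧ q ≠ p then x (p, q) - x (p, p) else 0) :
    corPolytopeGraph (⊤ : SimpleGraph (Fin n)) ∩ {x | c ⬝ᵥ x = 0} =
      corPolytopeGraph (⊤ : SimpleGraph (Fin n)) ∩ {x | B ⬝ᵥ x = 0} := by
  unfold corPolytopeGraph
  rw [convexHull_range_inter_eq _ c 0 hc.dot_le, convexHull_range_inter_eq _ B 0 (blockDir_dot_corVec_le β hB)]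
  congr 1
  ext x
  simp only [Set.mem_range]
  constructor
  · rintro ⟨⟨b, hb⟩, rfl⟩
    exact ⟨⟨b, dot_eq_zero_of_blockConst β hB ((hc.dot_eq_zero_iff b).1 hb)⟩, rfl⟩
  · rintro ⟨⟨b, hb⟩, rfl⟩
    exact ⟨⟨b, (hc.dot_eq_zero_iff b).2 (blockConst_of_dot_eq_zero β hB hb)⟩, rfl⟩

open Classical in
/-- ★ **THE ONE-CUT RUNG HOLDS**: one `face_add_face₁` with the admissible direction, `Admissible.face_eq`, the maximising
generators form a `J`-collinear family (`convexHull_collinear_pair`), then the landed read `funLeft_image_cor_blockFace`. -/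
theorem exposedFibreRung_holds : ExposedFibreRung := by
  intro n m β ρ hρ K q r hE hEF
  obtain ⟨c, hc, hthin⟩ := hE
  obtain ⟨B, hB⟩ := exists_blockDir β
  obtain ⟨j₀, -, hmax⟩ :=
    Finset.exists_max_image Finset.univ (fun j => c ⬝ᵥ q j) Finset.univ_nonempty
  have hQ : ∀ y ∈ convexHull ℝ (Set.range q), c ⬝ᵥ y ≤ c ⬝ᵥ q j₀ :=
    dot_le_of_mem_convexHull _ _ _ (by rintro _ ⟨j, rfl⟩; exact hmax j (Finset.mem_univ _))
  have hP : ∀ x ∈ corPolytopeGraph (⊤ : SimpleGraph (Fin n)), c ⬝ᵥ x ≤ 0 :=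
    dot_le_of_mem_convexHull _ _ _ (by rintro _ ⟨b, rfl⟩; exact hc.dot_le b)
  have h0 := hEF.face_add_face₁ c 0 (c ⬝ᵥ q j₀) hP hQ
  rw [hc.face_eq hB] at h0
  have hQeq : convexHull ℝ (Set.range q) ∩ {y | c ⬝ᵥ y = c ⬝ᵥ q j₀} =
      convexHull ℝ (q '' ((Finset.univ.filter fun j => c ⬝ᵥ q j = c ⬝ᵥ q j₀ : Finset (Fin (K + 1))) :
        Set (Fin (K + 1)))) := by
    rw [convexHull_range_inter_eq q c _ (fun j => hmax j (Finset.mem_univ _))]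
    congr 1
    ext y
    constructor
    · rintro ⟨⟨j, hj⟩, rfl⟩
      exact ⟨j, Finset.mem_coe.2 (Finset.mem_filter.2 ⟨Finset.mem_univ _, hj⟩), rfl⟩
    · rintro ⟨j, hj, rfl⟩
      exact ⟨⟨j, (Finset.mem_filter.1 (Finset.mem_coe.1 hj)).2⟩, rfl⟩
  rw [hQeq] at h0
  have hj₀ : j₀ ∈ (Finset.univ.filter fun j => c ⬝ᵥ q j = c ⬝ᵥ q j₀ : Finset (Fin (K + 1))) :=
    Finset.mem_filter.2 ⟨Finset.mem_univ _, rfl⟩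
  have hSmax : ∀ j ∈ (Finset.univ.filter fun j => c ⬝ᵥ q j = c ⬝ᵥ q j₀ : Finset (Fin (K + 1))),
      ∀ k, c ⬝ᵥ q k ≤ c ⬝ᵥ q j := fun j hj k => by
    rw [(Finset.mem_filter.1 hj).2]
    exact hmax k (Finset.mem_univ _)
  have hαex : ∀ j, ∃ α : ℝ, j ∈ (Finset.univ.filter fun j => c ⬝ᵥ q j = c ⬝ᵥ q j₀ : Finset (Fin (K + 1))) →
      q j - q j₀ = α • Jdir n := by
    intro j
    by_cases hj : j ∈ (Finset.univ.filter fun j => c ⬝ᵥ q j = c ⬝ᵥ q j₀ : Finset (Fin (K + 1)))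
    · obtain ⟨α, hα⟩ := hthin j j₀ (hSmax j hj) (hSmax j₀ hj₀)
      exact ⟨α, fun _ => hα⟩
    · exact ⟨0, fun h => (hj h).elim⟩
  choose α hα using hαex
  have hq : ∀ j ∈ (Finset.univ.filter fun j => c ⬝ᵥ q j = c ⬝ᵥ q j₀ : Finset (Fin (K + 1))),
      q j = q j₀ + α j • Jdir n := fun j hj => by
    rw [← hα j hj, add_sub_cancel]
  obtain ⟨a, -, b, -, hpair⟩ := convexHull_collinear_pair q (Jdir n) _ ⟨j₀, hj₀⟩ α (q j₀) hq
  rw [hpair] at h0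
  have h2 := h0.image_linearMap (LinearMap.funLeft ℝ ℝ (fun ij : Fin m × Fin m => (ρ ij.1, ρ ij.2)))
  rw [Set.image_add, funLeft_image_cor_blockFace β hB hρ, LinearMap.image_convexHull] at h2
  refine ⟨fun i => if i = 0 then LinearMap.funLeft ℝ ℝ (fun ij : Fin m × Fin m => (ρ ij.1, ρ ij.2)) (q a)
    else LinearMap.funLeft ℝ ℝ (fun ij : Fin m × Fin m => (ρ ij.1, ρ ij.2)) (q b), ?_⟩
  convert h2 using 3
  ext y
  constructor
  · rintro ⟨i, rfl⟩
    by_cases hi : i = 0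
    · exact ⟨q a, Or.inl rfl, by simp [hi]⟩
    · exact ⟨q b, Or.inr rfl, by simp [hi]⟩
  · rintro ⟨x, hx, rfl⟩
    rcases hx with rfl | hx
    · exact ⟨0, by simp⟩
    · rw [Set.mem_singleton_iff] at hx
      subst hx
      exact ⟨1, by simp⟩

/-- ★ … hence the count (PROP A at `K = 2`, ✓ `corPolytopeGraph_top_add_hull_three_pow_le`). -/
theorem exposedFibreDecided_holds : ExposedFibreDecided := by
  intro n m β ρ hρ K q r hE hEF
  obtain ⟨q', hq'⟩ := exposedFibreRung_holds n m β ρ hρ K q r hE hEF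
  have h := corPolytopeGraph_top_add_hull_three_pow_le q' (by norm_num) hq'
  calc 3 ^ m ≤ 2 * (r + 1) * 2 ^ m := h
    _ = (r + 1) * 2 ^ (m + 1) := by ring

/-! ## §2 The McCormick body is in `E♭ ∖ E♯`

`M_n = {Y symmetric : 0 ≤ Y_pq ≤ Y_pp ≤ 1, Y_pp + Y_qq − 1 ≤ Y_pq}` (= the rooted metric body `RMET_{n+1}` in
covariance coordinates; budgeted: `xc ≤ 4·n²` facets; in the open core of line rev 8 as typed, val-idea-41 (A)).
* NOT in E♯ (nor E) for ANY `β`: for a block `B` of `β` the functional `−Σ_{p∉B} Y_pp − Σ_{p,q∈B}(Y_pp − Y_pq)` is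
  `≤ 0` on `M_n` with equality exactly on the segment `[0, 𝟙_B𝟙_Bᵀ]` — an EDGE with block-constant, non-`J` direction.
* IN E♭ for every `β` whose blocks have size ≥ 2: `face_{C₀^β}(M_n) = {diagonal blocks constant =: y_s, cross cells
  free in [max(0, y_s+y_t−1), min(y_s, y_t)]}`; a direction `d ⊥ W_β` with symmetrised cross coefficients `d'_pq ≠ 0`
  summing to `0` over each block pair has `max_{face} d·Y = max_y Σ_{s<t} D⁺_{st}·g(y_s, y_t)` with
  `g(a,b) = min(a,b) − max(0,a+b−1) = min(a, b, 1−a, 1−b)` (`mcc_cell_gap`), uniquely maximal at `y ≡ ½`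
  (`mcc_cell_gap_le_half`, `mcc_cell_gap_eq_half_iff`); the cross cells are then pinned (`½` where `d' > 0`, `0` where
  `d' < 0`): the exposed fibre of `c = C₀^β + ε d` is ONE VERTEX `Y*`.  So `COR(K_n) + M_n` has the located face
  `F_β + {Y*}` and `3^m ≤ (r+1)·2^m` — no anchoring (41 (B)/AR1), no KMR (class K). -/

/-- the McCormick / rooted-metric body in `COR` coordinates. -/
def mcCormick (n : ℕ) : Set (Fin n × Fin n → ℝ) :=
  {Y | (∀ p q, Y (p, q) = Y (q, p)) ∧ (∀ p, 0 ≤ Y (p, p) ∧ Y (p, p) ≤ 1) ∧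
    ∀ p q, p ≠ q → 0 ≤ Y (p, q) ∧ Y (p, q) ≤ Y (p, p) ∧ Y (p, p) + Y (q, q) - 1 ≤ Y (p, q)}

/-- `C₀^β ≤ 0` on the McCormick body (each pair term `Y_pq − Y_pp ≤ 0`): the contraction cut is VALID on `M_n`,
so `face_c(COR + M_n) = F_β + face_c(M_n)` for admissible `c` near `C₀^β`. -/
theorem blockDir_nonpos_on_mcCormick (β : Fin n → Fin m) {Y : Fin n × Fin n → ℝ} (hY : Y ∈ mcCormick n) :
    (∑ p : Fin n, ∑ q : Fin n, if β q = β p ∧ q ≠ p then Y (p, q) - Y (p, p) else 0) ≤ 0 := by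
  refine Finset.sum_nonpos fun p _ => Finset.sum_nonpos fun q _ => ?_
  split_ifs with h
  · have := (hY.2.2 p q (Ne.symm h.2)).2.1
    linarith
  · exact le_rfl

/-- the width of a cross cell of the `C₀^β`-face of `M_n` as a function of the two diagonal values. -/
theorem mcc_cell_gap (a b : ℝ) (ha₀ : 0 ≤ a) (ha₁ : a ≤ 1) (hb₀ : 0 ≤ b) (hb₁ : b ≤ 1) :
    min a b - max 0 (a + b - 1) = min (min a b) (min (1 - a) (1 - b)) := by
  rcases le_total a b with hab | hab <;> rcases le_total 0 (a + b - 1) with h | h <;>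
    rcases le_total (1 - a) (1 - b) with h' | h' <;>
    simp only [min_eq_left, min_eq_right, max_eq_left, max_eq_right, hab, h, h', min_def] <;>
    split_ifs <;> linarith

/-- … it is at most `½` … -/
theorem mcc_cell_gap_le_half (a b : ℝ) : min (min a b) (min (1 - a) (1 - b)) ≤ 1 / 2 := by
  rcases le_total a (1 / 2) with h | h
  · exact (min_le_left _ _).trans ((min_le_left _ _).trans h)
  · exact (min_le_right _ _).trans ((min_le_left _ _).trans (by linarith))

/-- … with equality iff both diagonal values are `½`: the located objective `Σ D⁺_{st}·g(y_s,y_t)` (all `D⁺_{st} > 0`)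
has the UNIQUE maximiser `y ≡ ½`. -/
theorem mcc_cell_gap_eq_half_iff (a b : ℝ) :
    min (min a b) (min (1 - a) (1 - b)) = 1 / 2 ↔ a = 1 / 2 ∧ b = 1 / 2 := by
  constructor
  · intro h
    have h1 : 1 / 2 ≤ a := by rw [← h]; exact (min_le_left _ _).trans (min_le_left _ _)
    have h2 : 1 / 2 ≤ b := by rw [← h]; exact (min_le_left _ _).trans (min_le_right _ _)
    have h3 : 1 / 2 ≤ 1 - a := by rw [← h]; exact (min_le_right _ _).trans (min_le_left _ _)
    have h4 : 1 / 2 ≤ 1 - b := by rw [← h]; exact (min_le_right _ _).trans (min_le_right _ _)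
    constructor <;> linarith
  · rintro ⟨rfl, rfl⟩; norm_num

/-- **`M_n ∈ E♭`** (kernel food; the vertex family of `M_n` as generators; blocks of size ≥ 2 — with two singleton
blocks the unique cross cell between them is unpinned and the claim is false). -/
def McCormickExposedFibreBlind : Prop :=
  ∀ (n m : ℕ) (β : Fin n → Fin m), (∀ s, 2 ≤ (univ.filter fun p => β p = s).card) →
    ExposedFibreBlind β (fun v : (mcCormick n).extremePoints ℝ => (v : Fin n × Fin n → ℝ))

/-- **`M_n ∉ E♯`, witnessed by an edge** (kernel food, paper-trivial): for every nonempty block `B = β⁻¹(s)` the segment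
`[0, 𝟙_B𝟙_Bᵀ]` is an exposed edge of `M_n`; its direction is `BlockConstSymGen β` and not a multiple of `J` once `m ≥ 2`. -/
def McCormickBlockEdge : Prop :=
  ∀ (n m : ℕ) (β : Fin n → Fin m) (s : Fin m), 2 ≤ m → (∃ p, β p = s) →
    let g : Fin n × Fin n → ℝ := fun pq => if β pq.1 = s ∧ β pq.2 = s then 1 else 0
    (∃ φ : Fin n × Fin n → ℝ, ∃ δ : ℝ, (∀ Y ∈ mcCormick n, φ ⬝ᵥ Y ≤ δ) ∧
        mcCormick n ∩ {Y | φ ⬝ᵥ Y = δ} = segment ℝ 0 g) ∧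
      BlockConstSymGen β g ∧ ¬ ∃ α : ℝ, g = α • Jdir n

/-- the located consequence for the McCormick passenger — PROVED below (`mcCormickLocatedDecided_holds`, §2b: two exact
cuts `C₀^β` then the leader/second cross direction; read; PROP A with one passenger point). -/
def McCormickLocatedDecided : Prop :=
  ∀ (n m : ℕ) (β : Fin n → Fin m) (ρ : Fin m → Fin n), (∀ t, β (ρ t) = t) →
    (∀ s, 2 ≤ (univ.filter fun p => β p = s).card) → ∀ r : ℕ,
      HasEFOfSize (corPolytopeGraph (⊤ : SimpleGraph (Fin n)) + mcCormick n) r → 3 ^ m ≤ (r + 1) * 2 ^ m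

/-! ### §2b `McCormickLocatedDecided` — PROVED (critic price P-P2e, McCormick half): two EXACT cuts, no `ε`:
`C₀^β` (face `F_β + F'`, `F'` = diagonal blocks constant, `mcc_face_diag`), then the leader/second cross direction
`d(p,q) = [β p ≠ β q]·a_p a_q`, `a = 𝟙_{leaders ρ} − 𝟙_{seconds τ}` (block sums zero ⇒ `d ⊥ W_β`, `dot_eq_zero_on_face`);
on `F'` each block pair contributes `≤ 2·gap ≤ 1` with equality only at `y ≡ ½` and leader cells `½`, so the READ of the
`d`-face is the single point `½·J_m`; PROP A with `K = 1`. -/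

/-- on the `C₀^β`-face of `M_n` the diagonal blocks are constant: `Y_pq = Y_pp` within blocks. -/
theorem mcc_face_diag (β : Fin n → Fin m) {B : Fin n × Fin n → ℝ}
    (hB : ∀ x : Fin n × Fin n → ℝ,
      B ⬝ᵥ x = ∑ p : Fin n, ∑ q : Fin n, if β q = β p ∧ q ≠ p then x (p, q) - x (p, p) else 0)
    {Y : Fin n × Fin n → ℝ} (hY : Y ∈ mcCormick n) (hBY : B ⬝ᵥ Y = 0) :
    ∀ p q, β p = β q → Y (p, q) = Y (p, p) := by
  have hterm : ∀ p q, (if β q = β p ∧ q ≠ p then Y (p, q) - Y (p, p) else 0) ≤ 0 := fun p q => by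
    split_ifs with h
    · have := (hY.2.2 p q (Ne.symm h.2)).2.1
      linarith
    · exact le_rfl
  rw [hB] at hBY
  have hrow := (Finset.sum_eq_zero_iff_of_nonpos fun p _ => Finset.sum_nonpos fun q _ => hterm p q).1 hBY
  intro p q hpq
  by_cases hqp : q = p
  · rw [hqp]
  · have h1 := (Finset.sum_eq_zero_iff_of_nonpos fun q _ => hterm p q).1 (hrow p (Finset.mem_univ _)) q
      (Finset.mem_univ _)
    rw [if_pos ⟨hpq.symm, hqp⟩] at h1
    linarith

/-- an EF of size `0` describes an affine subspace: it is closed under point reflections. -/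
theorem two_smul_sub_mem_of_hasEFOfSize_zero {ι : Type} [Fintype ι] {S : Set (ι → ℝ)} (h : HasEFOfSize S 0)
    {u v : ι → ℝ} (hu : u ∈ S) (hv : v ∈ S) : (2 : ℝ) • u - v ∈ S := by
  obtain ⟨Q, rfl⟩ := h
  obtain ⟨yu, hyu, hu⟩ := hu
  obtain ⟨yv, -, hv⟩ := hv
  have hy : yv = yu := funext fun i => Fin.elim0 i
  rw [hy] at hv
  refine ⟨yu, hyu, ?_⟩
  funext i
  have h1 := congrFun hu i
  have h2 := congrFun hv i
  simp only [Pi.add_apply, Matrix.mulVec_sub, Matrix.mulVec_smul, Pi.sub_apply, Pi.smul_apply,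
    smul_eq_mul] at h1 h2 ⊢
  linarith

open Classical in
/-- ★ **`M_n` is DECIDED by its located face** — `xc(COR(K_n) + M_n) + 1 ≥ 1.5^m` for every `β` with blocks of size
`≥ 2` (so `m = ⌊n/2⌋` with the pairing): no anchoring, no KMR. -/
theorem mcCormickLocatedDecided_holds : McCormickLocatedDecided := by
  intro n m β ρ hρ hblk r hEF
  rcases Nat.lt_or_ge m 2 with hm | hm
  · interval_cases m
    · simp
    · -- one block: only `r ≥ 1` is claimed; an EF of size 0 would make `COR + M_n` an affine subspace
      rcases r with _ | r
      · exfalso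
        have p₀ : Fin n := ρ 0
        have h0M : (0 : Fin n × Fin n → ℝ) ∈ mcCormick n :=
          ⟨fun _ _ => rfl, fun _ => ⟨le_rfl, zero_le_one⟩, fun _ _ _ => ⟨le_rfl, le_rfl, by simp⟩⟩
        have h0C : (0 : Fin n × Fin n → ℝ) ∈ corPolytopeGraph (⊤ : SimpleGraph (Fin n)) := by
          unfold corPolytopeGraph
          refine subset_convexHull ℝ _ ⟨fun _ => false, ?_⟩
          ext ⟨p, q⟩
          rw [corVec_top_apply]
          simp
        have huC : corVec (⊤ : SimpleGraph (Fin n)) (fun _ => true) ∈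
            corPolytopeGraph (⊤ : SimpleGraph (Fin n)) := by
          unfold corPolytopeGraph
          exact subset_convexHull ℝ _ ⟨fun _ => true, rfl⟩
        have hS0 : (0 : Fin n × Fin n → ℝ) ∈ corPolytopeGraph (⊤ : SimpleGraph (Fin n)) + mcCormick n :=
          ⟨0, h0C, 0, h0M, add_zero 0⟩
        have hSu : corVec (⊤ : SimpleGraph (Fin n)) (fun _ => true) ∈
            corPolytopeGraph (⊤ : SimpleGraph (Fin n)) + mcCormick n :=
          ⟨_, huC, 0, h0M, add_zero _⟩
        obtain ⟨x, hx, Y, hY, hxY⟩ := two_smul_sub_mem_of_hasEFOfSize_zero hEF hS0 hSu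
        have hx0 : 0 ≤ x (p₀, p₀) := by
          unfold corPolytopeGraph at hx
          have h := dot_le_of_mem_convexHull _ (-(Pi.single (p₀, p₀) (1 : ℝ))) 0 (by
            rintro _ ⟨b, rfl⟩
            rw [neg_dotProduct, single_dotProduct, one_mul, corVec_top_apply]
            split_ifs <;> norm_num) x hx
          rw [neg_dotProduct, single_dotProduct, one_mul] at h
          linarith
        have hY0 : 0 ≤ Y (p₀, p₀) := (hY.2.1 p₀).1
        have h := congrFun hxY (p₀, p₀)
        simp only [Pi.add_apply, Pi.sub_apply, Pi.zero_apply, smul_zero, zero_sub, corVec_top_apply] at h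
        simp at h
        linarith
      · rw [pow_one, pow_one]
        omega
  -- main case `m ≥ 2`
  obtain ⟨B, hB⟩ := exists_blockDir β
  have hτex : ∀ s : Fin m, ∃ p, β p = s ∧ p ≠ ρ s := by
    intro s
    obtain ⟨p₁, hp₁, p₂, hp₂, hne⟩ := Finset.one_lt_card.1 (hblk s)
    by_cases h : p₁ = ρ s
    · exact ⟨p₂, (Finset.mem_filter.1 hp₂).2, fun h' => hne (h.trans h'.symm)⟩
    · exact ⟨p₁, (Finset.mem_filter.1 hp₁).2, h⟩
  choose τ hτβ hτne using hτex
  -- cut 1: `C₀^β`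
  have hM1 : ∀ Y ∈ mcCormick n, B ⬝ᵥ Y ≤ 0 := fun Y hY => by
    rw [hB]; exact blockDir_nonpos_on_mcCormick β hY
  have h1 := hEF.face_add_face₁ B 0 0 (blockDir_valid β hB) hM1
  -- the second direction
  obtain ⟨a, ha⟩ : ∃ a : Fin n → ℝ, ∀ p, a p =
      ∑ s : Fin m, ((if p = ρ s then (1 : ℝ) else 0) - (if p = τ s then 1 else 0)) := ⟨_, fun _ => rfl⟩
  obtain ⟨d, hd⟩ : ∃ d : Fin n × Fin n → ℝ, ∀ p q, d (p, q) = if β p = β q then 0 else a p * a q :=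
    ⟨fun pq => if β pq.1 = β pq.2 then 0 else a pq.1 * a pq.2, fun _ _ => rfl⟩
  have hsum_a : ∀ f : Fin n → ℝ, ∑ p, a p * f p = ∑ s, (f (ρ s) - f (τ s)) := by
    intro f
    have h1 : ∀ p, a p * f p = ∑ s, ((if p = ρ s then f p else 0) - (if p = τ s then f p else 0)) := by
      intro p
      rw [ha, Finset.sum_mul]
      refine Finset.sum_congr rfl fun s _ => ?_
      split_ifs <;> ring
    simp_rw [h1]
    rw [Finset.sum_comm]
    refine Finset.sum_congr rfl fun s _ => ?_
    simp [Finset.sum_sub_distrib]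
  -- `d ⊥ W_β`
  have hdw : ∀ w : Fin n × Fin n → ℝ, (∀ p q p' q', β p = β p' → β q = β q' → w (p, q) = w (p', q')) →
      d ⬝ᵥ w = 0 := by
    intro w hw
    have hterm : ∀ p q, d (p, q) * w (p, q) = a p * (a q * (if β p = β q then 0 else w (p, ρ (β q)))) := by
      intro p q
      rw [hd]
      split_ifs with h
      · ring
      · rw [hw p q p (ρ (β q)) rfl (hρ (β q)).symm]
        ring
    show ∑ pq, d pq * w pq = 0
    rw [Fintype.sum_prod_type]
    simp_rw [hterm, ← Finset.mul_sum]
    refine Finset.sum_eq_zero fun p _ => ?_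
    rw [hsum_a]
    simp [hρ, hτβ]
  -- `d ⬝ᵥ Y` as a sum over block pairs
  have hdY : ∀ Y : Fin n × Fin n → ℝ, d ⬝ᵥ Y = ∑ s, ∑ t, if s = t then (0 : ℝ) else
      Y (ρ s, ρ t) - Y (ρ s, τ t) - Y (τ s, ρ t) + Y (τ s, τ t) := by
    intro Y
    have hterm : ∀ p q, d (p, q) * Y (p, q) = a p * (a q * (if β p = β q then 0 else Y (p, q))) := by
      intro p q
      rw [hd]
      split_ifs <;> ring
    show ∑ pq, d pq * Y pq = _
    rw [Fintype.sum_prod_type]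
    simp_rw [hterm, ← Finset.mul_sum]
    rw [hsum_a]
    refine Finset.sum_congr rfl fun s _ => ?_
    rw [hsum_a, hsum_a, ← Finset.sum_sub_distrib]
    refine Finset.sum_congr rfl fun t _ => ?_
    simp only [hρ, hτβ]
    split_ifs <;> ring
  -- the block-pair inequality on `F'` and its equality case
  have hT : ∀ Y ∈ mcCormick n, (∀ p q, β p = β q → Y (p, q) = Y (p, p)) → ∀ s t, s ≠ t →
      Y (ρ s, ρ t) - Y (ρ s, τ t) - Y (τ s, ρ t) + Y (τ s, τ t) ≤ 1 ∧
      (Y (ρ s, ρ t) - Y (ρ s, τ t) - Y (τ s, ρ t) + Y (τ s, τ t) = 1 →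
        Y (ρ s, ρ s) = 1 / 2 ∧ Y (ρ s, ρ t) = 1 / 2) := by
    intro Y hY hdiag s t hst
    have hsym := hY.1
    have hne1 : ρ s ≠ ρ t := fun h => hst (by rw [← hρ s, h, hρ t])
    have hne2 : ρ s ≠ τ t := fun h => hst (by rw [← hρ s, h, hτβ t])
    have hne3 : τ s ≠ ρ t := fun h => hst (by rw [← hτβ s, h, hρ t])
    have hne4 : τ s ≠ τ t := fun h => hst (by rw [← hτβ s, h, hτβ t])
    have hτs : Y (τ s, τ s) = Y (ρ s, ρ s) := by
      rw [← hdiag (τ s) (ρ s) (by rw [hτβ, hρ]), hsym, hdiag (ρ s) (τ s) (by rw [hτβ, hρ])]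
    have hτt : Y (τ t, τ t) = Y (ρ t, ρ t) := by
      rw [← hdiag (τ t) (ρ t) (by rw [hτβ, hρ]), hsym, hdiag (ρ t) (τ t) (by rw [hτβ, hρ])]
    obtain ⟨-, h1b, -⟩ := hY.2.2 _ _ hne1
    obtain ⟨-, h1c, -⟩ := hY.2.2 _ _ hne1.symm
    obtain ⟨h2a, -, h2c⟩ := hY.2.2 _ _ hne2
    obtain ⟨h3a, -, h3c⟩ := hY.2.2 _ _ hne3
    obtain ⟨-, h4b, -⟩ := hY.2.2 _ _ hne4
    obtain ⟨-, h4c, -⟩ := hY.2.2 _ _ hne4.symm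
    rw [hsym (ρ t) (ρ s)] at h1c
    rw [hsym (τ t) (τ s)] at h4c
    rw [hτs] at h4b h3c
    rw [hτt] at h4c h2c
    constructor
    · linarith
    · intro hT1
      constructor <;> linarith
  -- cut 2
  have hMd : ∀ Y ∈ mcCormick n ∩ {Y | B ⬝ᵥ Y = 0},
      d ⬝ᵥ Y ≤ ∑ s : Fin m, ∑ t : Fin m, (if s = t then (0 : ℝ) else 1) := by
    rintro Y ⟨hY, hBY⟩
    have hdiag := mcc_face_diag β hB hY hBY
    rw [hdY]
    refine Finset.sum_le_sum fun s _ => Finset.sum_le_sum fun t _ => ?_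
    split_ifs with hst
    · exact le_rfl
    · exact (hT Y hY hdiag s t hst).1
  have hpt : ∀ Y ∈ mcCormick n ∩ {Y | B ⬝ᵥ Y = 0},
      d ⬝ᵥ Y = ∑ s : Fin m, ∑ t : Fin m, (if s = t then (0 : ℝ) else 1) → ∀ s t, Y (ρ s, ρ t) = 1 / 2 := by
    rintro Y ⟨hY, hBY⟩ hface
    have hdiag := mcc_face_diag β hB hY hBY
    rw [hdY] at hface
    have hle : ∀ s ∈ (Finset.univ : Finset (Fin m)), ∀ t ∈ (Finset.univ : Finset (Fin m)),
        (if s = t then (0 : ℝ) else Y (ρ s, ρ t) - Y (ρ s, τ t) - Y (τ s, ρ t) + Y (τ s, τ t)) ≤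
          (if s = t then (0 : ℝ) else 1) := by
      intro s _ t _
      split_ifs with hst
      · exact le_rfl
      · exact (hT Y hY hdiag s t hst).1
    have hrow := (Finset.sum_eq_sum_iff_of_le fun s hs => Finset.sum_le_sum (hle s hs)).1 hface
    have hcell : ∀ s t, s ≠ t → Y (ρ s, ρ s) = 1 / 2 ∧ Y (ρ s, ρ t) = 1 / 2 := by
      intro s t hst
      have h := (Finset.sum_eq_sum_iff_of_le (hle s (Finset.mem_univ _))).1 (hrow s (Finset.mem_univ _)) t
        (Finset.mem_univ _)
      rw [if_neg hst, if_neg hst] at h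
      exact (hT Y hY hdiag s t hst).2 h
    intro s t
    by_cases hst : s = t
    · subst hst
      obtain ⟨t', ht'⟩ := Fintype.exists_ne_of_one_lt_card (by rw [Fintype.card_fin]; omega) s
      exact (hcell s t' (Ne.symm ht')).1
    · exact (hcell s t hst).2
  -- the pinned vertex `Y*`
  obtain ⟨Ys, hYs⟩ : ∃ Ys : Fin n × Fin n → ℝ, ∀ p q, Ys (p, q) =
      if β p = β q ∨ (p = ρ (β p) ∧ q = ρ (β q)) ∨ (p = τ (β p) ∧ q = τ (β q)) then 1 / 2 else 0 :=
    ⟨fun pq => if β pq.1 = β pq.2 ∨ (pq.1 = ρ (β pq.1) ∧ pq.2 = ρ (β pq.2)) ∨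
      (pq.1 = τ (β pq.1) ∧ pq.2 = τ (β pq.2)) then 1 / 2 else 0, fun _ _ => rfl⟩
  have hYpp : ∀ p, Ys (p, p) = 1 / 2 := fun p => by rw [hYs]; simp
  have hYsM : Ys ∈ mcCormick n := by
    refine ⟨fun p q => ?_, fun p => ?_, fun p q hpq => ?_⟩
    · rw [hYs, hYs]
      refine if_congr ⟨?_, ?_⟩ rfl rfl
      · rintro (h | ⟨h1, h2⟩ | ⟨h1, h2⟩)
        · exact Or.inl h.symm
        · exact Or.inr (Or.inl ⟨h2, h1⟩)
        · exact Or.inr (Or.inr ⟨h2, h1⟩)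
      · rintro (h | ⟨h1, h2⟩ | ⟨h1, h2⟩)
        · exact Or.inl h.symm
        · exact Or.inr (Or.inl ⟨h2, h1⟩)
        · exact Or.inr (Or.inr ⟨h2, h1⟩)
    · rw [hYpp]; norm_num
    · rw [hYpp, hYpp, hYs]
      split_ifs <;> norm_num
  have hYsB : B ⬝ᵥ Ys = 0 := by
    rw [hB]
    refine Finset.sum_eq_zero fun p _ => Finset.sum_eq_zero fun q _ => ?_
    split_ifs with h
    · rw [hYpp, hYs, if_pos (Or.inl h.1.symm)]
      ring
    · rfl
  have hYsd : d ⬝ᵥ Ys = ∑ s : Fin m, ∑ t : Fin m, (if s = t then (0 : ℝ) else 1) := by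
    rw [hdY]
    refine Finset.sum_congr rfl fun s _ => Finset.sum_congr rfl fun t _ => ?_
    split_ifs with hst
    · rfl
    · have e1 : Ys (ρ s, ρ t) = 1 / 2 := by rw [hYs]; simp [hρ]
      have e2 : Ys (ρ s, τ t) = 0 := by rw [hYs]; simp [hρ, hτβ, hst, hτne t, (hτne s).symm]
      have e3 : Ys (τ s, ρ t) = 0 := by rw [hYs]; simp [hρ, hτβ, hst, hτne s, (hτne t).symm]
      have e4 : Ys (τ s, τ t) = 1 / 2 := by rw [hYs]; simp [hτβ]
      rw [e1, e2, e3, e4]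
      norm_num
  -- assemble: second cut, read, PROP A with one passenger point
  have hPd : ∀ x ∈ corPolytopeGraph (⊤ : SimpleGraph (Fin n)) ∩ {x | B ⬝ᵥ x = 0}, d ⬝ᵥ x = 0 :=
    dot_eq_zero_on_face β hB (fun w hw => hdw w (blockConstSym_of_mem_span β hw).2)
  have h2 := h1.face_add_face₁ d 0 _ (fun x hx => (hPd x hx).le) hMd
  have hPeq : (corPolytopeGraph (⊤ : SimpleGraph (Fin n)) ∩ {x | B ⬝ᵥ x = 0}) ∩ {x | d ⬝ᵥ x = 0} =
      corPolytopeGraph (⊤ : SimpleGraph (Fin n)) ∩ {x | B ⬝ᵥ x = 0} :=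
    Set.inter_eq_left.2 fun x hx => hPd x hx
  rw [hPeq] at h2
  have h3 := h2.image_linearMap (LinearMap.funLeft ℝ ℝ (fun ij : Fin m × Fin m => (ρ ij.1, ρ ij.2)))
  rw [Set.image_add, funLeft_image_cor_blockFace β hB hρ] at h3
  have himg : LinearMap.funLeft ℝ ℝ (fun ij : Fin m × Fin m => (ρ ij.1, ρ ij.2)) ''
      ((mcCormick n ∩ {Y | B ⬝ᵥ Y = 0}) ∩
        {Y | d ⬝ᵥ Y = ∑ s : Fin m, ∑ t : Fin m, (if s = t then (0 : ℝ) else 1)}) =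
      convexHull ℝ (Set.range fun _ : Fin 1 => (fun _ : Fin m × Fin m => (1 / 2 : ℝ))) := by
    rw [Set.range_const, convexHull_singleton]
    apply Set.Subset.antisymm
    · rintro _ ⟨Y, ⟨hYF, hface⟩, rfl⟩
      refine Set.mem_singleton_iff.2 (funext fun st => ?_)
      rw [LinearMap.funLeft_apply]
      exact hpt Y hYF hface st.1 st.2
    · intro z hz
      rw [Set.mem_singleton_iff.1 hz]
      refine ⟨Ys, ⟨⟨hYsM, hYsB⟩, hYsd⟩, funext fun st => ?_⟩
      rw [LinearMap.funLeft_apply]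
      obtain ⟨s, t⟩ := st
      by_cases hst : s = t
      · subst hst
        exact hYpp _
      · show Ys (ρ s, ρ t) = 1 / 2
        rw [hYs]; simp [hρ]
  rw [himg] at h3
  have h4 := corPolytopeGraph_top_add_hull_three_pow_le _ (by norm_num) h3
  simpa using h4

/-! ## §3 `MET`: fixed point of the `C₀^β`-chamber, killed from the pentagonal chamber

`MET_{n+1}` in covariance coordinates (`x_{0p} = Y_pp`, `x_pq = Y_pp + Y_qq − 2Y_pq`): the rooted triangles are the
McCormick inequalities, the unrooted ones read `Y_pr + Y_qr − Y_pq ≤ Y_rr` and `Y_pp + Y_qq + Y_rr − Y_pq − Y_pr − Y_qr ≤ 1`.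

### §3a  the `C₀^β`-chamber is blind (fixed point)
On the `C₀^β`-face (`Y_pq = Y_pp` within blocks, i.e. `x_pq = 0`; note `C₀^β = −Σ_{same block} x_pq`) the triangle
inequalities force `x_pr = x_qr` (`met_contract`): the face is ENTIRELY block-constant (⊆ `W_β`) and reads onto
`MET^{COR}_{m+1}` (`MetFixedPoint`).  So every direction `C₀^β + εd`, `d ⊥ W_β`, has the whole `MET_{m+1}`-face as
fibre, and every `C₀^β`-first located certificate (E, E♯, the landed engine's reads, their compositions with a scale-`m`
certificate `X`) is exactly as strong on `MET` as `X` one scale down — monotone-only.  Same for `Z_full`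
(38 `TowerContractionRung`, `P = ⊤`) and `COR` (`funLeft_image_cor_blockFace`): `ContractionClosed` species.

### §3b  the pentagonal chamber bites
Split every block (size ≥ 2) into a-type and b-type points (both nonempty).  A CONFIGURATION is
`(root; a ∈ B_s^a, b ∈ B_s^b; a' ∈ B_t^a, b' ∈ B_t^b)`, `s ≠ t`, with signs `σ = −1` on `a, a'` and `+1` on `root, b, b'`;
its pentagonal functional `P_σ(x) = Σ_{i<j} σ_iσ_j x_ij` satisfies `P_σ(δ(S)) = s_S(1 − s_S) ≤ 0` on cuts, `= 0` on every
union of blocks (`s_S = 0`: one `+` and one `−` per block) — so `P_σ ⊥ W_β` and `c₁ := Σ_config P_σ` is valid on `COR(K_n)`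
with `c₁`-face `⊇ F_β` —, while on `MET` (`pentagonal_le`, `pentagonal_eq`): `P_σ ≤ 2/3` with equality iff the restriction
to the configuration is the anti-cut `⅔𝟙 − ⅓δ({a,a'})`.  The point `y_A := ⅔𝟙 − ⅓δ(a-type points)` maximises every
configuration at once, so `face_{c₁}(MET)` = {all configured pairs pinned; only same-type twins free}, and the second cut
`C₀^β = −Σ_{same block} x_pq` pins the twins to distance `0`: `face_{C₀^β}(face_{c₁}(COR + MET)) = F_β + {x*}`.  Two exact
cuts (`face_add_face₁` twice), read, FMPTdW: `3^m ≤ (r+1)·2^m` (`MetLocatedDecided`); equivalently `MET ∈ E♭` with the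
admissible direction `c₁ + ε C₀^β` (`MetExposedFibreBlind`).  With the pairing `β` (`m = ⌊n/2⌋`):
`xc(COR(K_n) + MET^{COR}_{n+1}) + 1 ≥ 1.5^{⌊n/2⌋}` — no anchoring (41 AR1/AR2), no KMR. -/

/-- the metric body `MET_{n+1}` in `COR` coordinates. -/
def metCor (n : ℕ) : Set (Fin n × Fin n → ℝ) :=
  mcCormick n ∩ {Y | ∀ p q r, p ≠ q → q ≠ r → p ≠ r →
    Y (p, r) + Y (q, r) - Y (p, q) ≤ Y (r, r) ∧ Y (p, p) + Y (q, q) + Y (r, r) - Y (p, q) - Y (p, r) - Y (q, r) ≤ 1}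

/-- **contraction lemma** (§3a): on the `C₀^β`-face of `MET` (`x_pq = 0`, i.e. `Y_pq = Y_pp = Y_qq`) rows `p`, `q` agree. -/
theorem met_contract {Y : Fin n × Fin n → ℝ} (hY : Y ∈ metCor n) {p q : Fin n} (hpq : p ≠ q)
    (h₁ : Y (p, q) = Y (p, p)) (h₂ : Y (p, q) = Y (q, q)) (r : Fin n) : Y (p, r) = Y (q, r) := by
  obtain ⟨hM, hT⟩ := hY
  have hsym := hM.1
  by_cases hpr : p = r
  · subst hpr; rw [hsym q p, h₁]
  by_cases hqr : q = r
  · subst hqr; exact h₂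
  have t₁ := (hT p r q hpr (Ne.symm hqr) hpq).1
  have t₂ := (hT q r p hqr (Ne.symm hpr) (Ne.symm hpq)).1
  rw [hsym r q] at t₁
  rw [hsym q p, hsym r p] at t₂
  linarith

/-- **`MET` is a fixed point of the `C₀^β`-first located read** (§3a; kernel food: `⊆` = `met_contract` + read;
`⊇` = lift `Y(p,q) := Z(β p, β q)`, the triangle inequalities with repeated blocks follow from McCormick). -/
def MetFixedPoint : Prop :=
  ∀ (n m : ℕ) (β : Fin n → Fin m) (ρ : Fin m → Fin n), (∀ t, β (ρ t) = t) →
    (LinearMap.funLeft ℝ ℝ fun ij : Fin m × Fin m => (ρ ij.1, ρ ij.2)) ''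
        (metCor n ∩ {Y | ∀ p q, β p = β q → Y (p, q) = Y (p, p)}) = metCor m

/-- every point of the `C₀^β`-face of `MET` is symmetric block-constant (⊆ `W_β`): no `C₀^β`-perturbative direction
cuts it (§3a; PROVED below, `metFaceBlockConst_holds`). -/
def MetFaceBlockConst : Prop :=
  ∀ (n m : ℕ) (β : Fin n → Fin m), ∀ Y ∈ metCor n, (∀ p q, β p = β q → Y (p, q) = Y (p, p)) → BlockConstSymGen β Y

/-- §3a in kernel: the `C₀^β`-face of `MET` lies inside `W_β` (symmetric and `β`-block-constant). -/
theorem metFaceBlockConst_holds : MetFaceBlockConst := by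
  intro n m β Y hY hface
  have hsym : ∀ p q, Y (p, q) = Y (q, p) := hY.1.1
  -- rows of two points of one block agree
  have hrow : ∀ p p₂, β p = β p₂ → ∀ r, Y (p, r) = Y (p₂, r) := by
    intro p p₂ hpp r
    by_cases hne : p = p₂
    · rw [hne]
    · have h₁ : Y (p, p₂) = Y (p, p) := hface p p₂ hpp
      have h₂ : Y (p, p₂) = Y (p₂, p₂) := by rw [hsym p p₂, hface p₂ p hpp.symm]
      exact met_contract hY hne h₁ h₂ r
  refine ⟨hsym, fun p p₁ p₂ p₃ hp hp₁ => ?_⟩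
  rw [hrow p p₂ hp p₁, hsym p₂ p₁, hrow p₁ p₃ hp₁ p₂, hsym p₃ p₂]

/-- **CONTRACTION-CLOSED species** (§3a): the `C₀^β`-face of `P n` is block-constant and reads onto `P m`.  On such a
species every `C₀^β`-first located certificate composed with a scale-`m` certificate `X` is exactly as strong as `X`. -/
def ContractionClosed (P : (k : ℕ) → Set (Fin k × Fin k → ℝ)) : Prop :=
  ∀ (n m : ℕ) (β : Fin n → Fin m) (ρ : Fin m → Fin n), (∀ t, β (ρ t) = t) →
    (∀ Y ∈ P n, (∀ p q, β p = β q → Y (p, q) = Y (p, p)) → BlockConstSymGen β Y) ∧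
    (LinearMap.funLeft ℝ ℝ fun ij : Fin m × Fin m => (ρ ij.1, ρ ij.2)) ''
        (P n ∩ {Y | ∀ p q, β p = β q → Y (p, q) = Y (p, p)}) = P m

/-- `MET` is contraction-closed (= `MetFaceBlockConst ∧ MetFixedPoint`); so are `COR` (`funLeft_image_cor_blockFace`,
landed) and `Z_full` (38 `TowerContractionRung` with `P = ⊤`). -/
def MetContractionClosed : Prop := ContractionClosed metCor

/-- ★ **PENTAGONAL CERTIFICATE on `MET`** (§3b, proved): for distinct non-root points `i j` (signs `+`) and `k l`
(signs `−`; the root is the third `+`), `½·P_σ = Y_ik + Y_il + Y_jk + Y_jl − Y_ij − Y_kl − Y_kk − Y_ll ≤ ⅓` on `MET` —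
Farkas certificate `⅓·perimeter(root,i,j) + ⅓·Σ (nine triangle inequalities)`. -/
theorem pentagonal_le {Y : Fin n × Fin n → ℝ} (hY : Y ∈ metCor n) {i j k l : Fin n}
    (hij : i ≠ j) (hik : i ≠ k) (hil : i ≠ l) (hjk : j ≠ k) (hjl : j ≠ l) (hkl : k ≠ l) :
    Y (i, k) + Y (i, l) + Y (j, k) + Y (j, l) - Y (i, j) - Y (k, l) - Y (k, k) - Y (l, l) ≤ 1 / 3 := by
  obtain ⟨⟨hsym, hdiag, hM⟩, hT⟩ := hY
  have e1 := (hM i j hij).2.2          -- perimeter (root,i,j):  Y ii + Y jj - 1 ≤ Y ij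
  have e2 := (hM k l hkl).1            -- x_kl ≤ x_0k + x_0l :   0 ≤ Y kl
  have e3 := (hT k l i hkl (Ne.symm hil) (Ne.symm hik)).1   -- x_kl ≤ x_ik + x_il
  have e4 := (hT k l j hkl (Ne.symm hjl) (Ne.symm hjk)).1   -- x_kl ≤ x_jk + x_jl
  have e5 := (hT i j k hij hjk hik).1                       -- x_ij ≤ x_ik + x_jk
  have e6 := (hT i j l hij hjl hil).1                       -- x_ij ≤ x_il + x_jl
  have e7 := (hM k i (Ne.symm hik)).2.1   -- x_0i ≤ x_0k + x_ik :  Y ki ≤ Y kk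
  have e8 := (hM l i (Ne.symm hil)).2.1
  have e9 := (hM k j (Ne.symm hjk)).2.1
  have e10 := (hM l j (Ne.symm hjl)).2.1
  rw [hsym k i] at e3 e7; rw [hsym l i] at e3 e8; rw [hsym k j] at e4 e9; rw [hsym l j] at e4 e10
  linarith

/-- ★ … with EQUALITY only at the anti-cut `⅔𝟙 − ⅓δ({k,l})` restricted to the configuration (§3b, proved): the pentagonal
direction exposes ONE point of `MET₅`. -/
theorem pentagonal_eq {Y : Fin n × Fin n → ℝ} (hY : Y ∈ metCor n) {i j k l : Fin n}
    (hij : i ≠ j) (hik : i ≠ k) (hil : i ≠ l) (hjk : j ≠ k) (hjl : j ≠ l) (hkl : k ≠ l)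
    (h : Y (i, k) + Y (i, l) + Y (j, k) + Y (j, l) - Y (i, j) - Y (k, l) - Y (k, k) - Y (l, l) = 1 / 3) :
    Y (i, i) = 2 / 3 ∧ Y (j, j) = 2 / 3 ∧ Y (k, k) = 1 / 3 ∧ Y (l, l) = 1 / 3 ∧ Y (i, j) = 1 / 3 ∧ Y (k, l) = 0 ∧
      Y (i, k) = 1 / 3 ∧ Y (i, l) = 1 / 3 ∧ Y (j, k) = 1 / 3 ∧ Y (j, l) = 1 / 3 := by
  obtain ⟨⟨hsym, hdiag, hM⟩, hT⟩ := hY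
  have e1 := (hM i j hij).2.2
  have e2 := (hM k l hkl).1
  have e3 := (hT k l i hkl (Ne.symm hil) (Ne.symm hik)).1
  have e4 := (hT k l j hkl (Ne.symm hjl) (Ne.symm hjk)).1
  have e5 := (hT i j k hij hjk hik).1
  have e6 := (hT i j l hij hjl hil).1
  have e7 := (hM k i (Ne.symm hik)).2.1
  have e8 := (hM l i (Ne.symm hil)).2.1
  have e9 := (hM k j (Ne.symm hjk)).2.1
  have e10 := (hM l j (Ne.symm hjl)).2.1
  rw [hsym k i] at e3 e7; rw [hsym l i] at e3 e8; rw [hsym k j] at e4 e9; rw [hsym l j] at e4 e10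
  refine ⟨?_, ?_, ?_, ?_, ?_, ?_, ?_, ?_, ?_, ?_⟩ <;> linarith

/-- **`MET ∈ E♭`** (§3b; kernel food): for every block map whose blocks have size ≥ 2, the admissible direction
`Σ_config P_σ + ε C₀^β` has a ONE-POINT maximiser set among the vertices of `MET^{COR}_{n+1}`. -/
def MetExposedFibreBlind : Prop :=
  ∀ (n m : ℕ) (β : Fin n → Fin m), (∀ s, 2 ≤ (univ.filter fun p => β p = s).card) →
    ExposedFibreBlind β (fun v : (metCor n).extremePoints ℝ => (v : Fin n × Fin n → ℝ))

/-- ★ **`COR(K_n) + MET_{n+1}` IS HARD BY ONE EXACT CUT** — PROVED below (`metLocatedDecided_holds`, §3c: `face_add_face₁`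
with `c₁ = Σ P_σ` — `pentagonal_le`/`pentagonal_eq` pin the read —, `funLeft_image_of_between`, PROP A).  With the pairing:
`xc + 1 ≥ 1.5^{⌊n/2⌋}`.  41's residual enemy `MET` dies WITHOUT anchoring. -/
def MetLocatedDecided : Prop :=
  ∀ (n m : ℕ) (β : Fin n → Fin m) (ρ : Fin m → Fin n), (∀ t, β (ρ t) = t) →
    (∀ s, 2 ≤ (univ.filter fun p => β p = s).card) → ∀ r : ℕ,
      HasEFOfSize (corPolytopeGraph (⊤ : SimpleGraph (Fin n)) + metCor n) r → 3 ^ m ≤ (r + 1) * 2 ^ m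

/-! ### §3c `MetLocatedDecided` — PROVED (critic price P-P2e, `MET` half): ONE exact cut with the pentagonal sum
`c₁ = Σ_{s≠t} P_{(τ s, τ t; ρ s, ρ t)}` — valid on `COR(K_n)` (`P(δ_S) = s_S(1−s_S)/2 ≤ 0`), vanishing on `W_β`
(`blockConstSym_of_mem_span`), `≤ 1/3` per configuration on `MET` (`pentagonal_le`) with the anti-cut read forced
(`pentagonal_eq`) — and the observation that ANY face of `COR(K_n)` between `F_β` and `COR(K_n)` reads onto `COR(K_m)`
(`funLeft_image_of_between`): the second cut of §3b is not needed.  PROP A with one passenger point. -/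

/-- the read `(ρ × ρ)^*` maps every face of `COR(K_n)` containing the contraction face ONTO `COR(K_m)`. -/
theorem funLeft_image_of_between (β : Fin n → Fin m) {B : Fin n × Fin n → ℝ}
    (hB : ∀ x : Fin n × Fin n → ℝ,
      B ⬝ᵥ x = ∑ p : Fin n, ∑ q : Fin n, if β q = β p ∧ q ≠ p then x (p, q) - x (p, p) else 0)
    {ρ : Fin m → Fin n} (hρ : ∀ t, β (ρ t) = t) {G : Set (Fin n × Fin n → ℝ)}
    (h₁ : corPolytopeGraph (⊤ : SimpleGraph (Fin n)) ∩ {x | B ⬝ᵥ x = 0} ⊆ G)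
    (h₂ : G ⊆ corPolytopeGraph (⊤ : SimpleGraph (Fin n))) :
    LinearMap.funLeft ℝ ℝ (fun ij : Fin m × Fin m => (ρ ij.1, ρ ij.2)) '' G =
      corPolytopeGraph (⊤ : SimpleGraph (Fin m)) := by
  apply Set.Subset.antisymm
  · rintro _ ⟨x, hx, rfl⟩
    unfold corPolytopeGraph
    have hx' : x ∈ convexHull ℝ (Set.range (corVec (⊤ : SimpleGraph (Fin n)))) := h₂ hx
    have hmem : LinearMap.funLeft ℝ ℝ (fun ij : Fin m × Fin m => (ρ ij.1, ρ ij.2)) x ∈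
        LinearMap.funLeft ℝ ℝ (fun ij : Fin m × Fin m => (ρ ij.1, ρ ij.2)) ''
          convexHull ℝ (Set.range (corVec (⊤ : SimpleGraph (Fin n)))) := ⟨x, hx', rfl⟩
    rw [LinearMap.image_convexHull] at hmem
    refine convexHull_mono ?_ hmem
    rintro _ ⟨_, ⟨b, rfl⟩, rfl⟩
    refine ⟨b ∘ ρ, ?_⟩
    ext ⟨s, t⟩
    simp only [LinearMap.funLeft_apply, corVec_top_apply, Function.comp_apply]
    rfl
  · rw [← funLeft_image_cor_blockFace β hB hρ]
    exact Set.image_mono h₁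

/-- `COR(K_n) + M` is never an affine subspace when `M ∋ 0` has a nonnegative diagonal entry: size `0` is impossible. -/
theorem not_hasEFOfSize_zero_cor_add (p₀ : Fin n) {M : Set (Fin n × Fin n → ℝ)} (h0M : (0 : Fin n × Fin n → ℝ) ∈ M)
    (hM : ∀ Y ∈ M, 0 ≤ Y (p₀, p₀)) :
    ¬ HasEFOfSize (corPolytopeGraph (⊤ : SimpleGraph (Fin n)) + M) 0 := by
  intro hEF
  have h0C : (0 : Fin n × Fin n → ℝ) ∈ corPolytopeGraph (⊤ : SimpleGraph (Fin n)) := by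
    unfold corPolytopeGraph
    refine subset_convexHull ℝ _ ⟨fun _ => false, ?_⟩
    ext ⟨p, q⟩
    rw [corVec_top_apply]
    simp
  have huC : corVec (⊤ : SimpleGraph (Fin n)) (fun _ => true) ∈ corPolytopeGraph (⊤ : SimpleGraph (Fin n)) := by
    unfold corPolytopeGraph
    exact subset_convexHull ℝ _ ⟨fun _ => true, rfl⟩
  have hS0 : (0 : Fin n × Fin n → ℝ) ∈ corPolytopeGraph (⊤ : SimpleGraph (Fin n)) + M :=
    ⟨0, h0C, 0, h0M, add_zero 0⟩
  have hSu : corVec (⊤ : SimpleGraph (Fin n)) (fun _ => true) ∈ corPolytopeGraph (⊤ : SimpleGraph (Fin n)) + M :=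
    ⟨_, huC, 0, h0M, add_zero _⟩
  obtain ⟨x, hx, Y, hY, hxY⟩ := two_smul_sub_mem_of_hasEFOfSize_zero hEF hS0 hSu
  have hx0 : 0 ≤ x (p₀, p₀) := by
    unfold corPolytopeGraph at hx
    have h := dot_le_of_mem_convexHull _ (-(Pi.single (p₀, p₀) (1 : ℝ))) 0 (by
      rintro _ ⟨b, rfl⟩
      rw [neg_dotProduct, single_dotProduct, one_mul, corVec_top_apply]
      split_ifs <;> norm_num) x hx
    rw [neg_dotProduct, single_dotProduct, one_mul] at h
    linarith
  have hY0 := hM Y hY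
  have h := congrFun hxY (p₀, p₀)
  simp only [Pi.add_apply, Pi.sub_apply, Pi.zero_apply, smul_zero, zero_sub, corVec_top_apply] at h
  simp at h
  linarith

open Classical in
/-- ★ **`MET` is DECIDED by its located face** — `xc(COR(K_n) + MET^{COR}_{n+1}) + 1 ≥ 1.5^m` for every `β` with
blocks of size `≥ 2` (`m = ⌊n/2⌋` with the pairing): no anchoring, no KMR; the recorded «MET fixed point» holds for the
`C₀^β`-chamber only. -/
theorem metLocatedDecided_holds : MetLocatedDecided := by
  intro n m β ρ hρ hblk r hEF
  rcases Nat.lt_or_ge m 2 with hm | hm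
  · interval_cases m
    · simp
    · rcases r with _ | r
      · exfalso
        have h0M : (0 : Fin n × Fin n → ℝ) ∈ metCor n :=
          ⟨⟨fun _ _ => rfl, fun _ => ⟨le_rfl, zero_le_one⟩, fun _ _ _ => ⟨le_rfl, le_rfl, by simp⟩⟩,
            fun _ _ _ _ _ _ => ⟨by simp, by simp⟩⟩
        exact not_hasEFOfSize_zero_cor_add (ρ 0) h0M (fun Y hY => (hY.1.2.1 (ρ 0)).1) hEF
      · rw [pow_one, pow_one]
        omega
  -- main case `m ≥ 2`
  obtain ⟨B, hB⟩ := exists_blockDir β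
  have hτex : ∀ s : Fin m, ∃ p, β p = s ∧ p ≠ ρ s := by
    intro s
    obtain ⟨p₁, hp₁, p₂, hp₂, hne⟩ := Finset.one_lt_card.1 (hblk s)
    by_cases h : p₁ = ρ s
    · exact ⟨p₂, (Finset.mem_filter.1 hp₂).2, fun h' => hne (h.trans h'.symm)⟩
    · exact ⟨p₁, (Finset.mem_filter.1 hp₁).2, h⟩
  choose τ hτβ hτne using hτex
  have hne : ∀ s t : Fin m, s ≠ t → ρ s ≠ ρ t ∧ ρ s ≠ τ t ∧ τ s ≠ ρ t ∧ τ s ≠ τ t := fun s t hst =>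
    ⟨fun h => hst (by rw [← hρ s, h, hρ t]), fun h => hst (by rw [← hρ s, h, hτβ t]),
      fun h => hst (by rw [← hτβ s, h, hρ t]), fun h => hst (by rw [← hτβ s, h, hτβ t])⟩
  -- the pentagonal sum `c₁`
  obtain ⟨Pv, hPv⟩ : ∃ Pv : Fin m → Fin m → (Fin n × Fin n → ℝ), ∀ s t x, Pv s t ⬝ᵥ x =
      x (τ s, ρ s) + x (τ s, ρ t) + x (τ t, ρ s) + x (τ t, ρ t) - x (τ s, τ t) - x (ρ s, ρ t) -
        x (ρ s, ρ s) - x (ρ t, ρ t) := by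
    refine ⟨fun s t => Pi.single (τ s, ρ s) 1 + Pi.single (τ s, ρ t) 1 + Pi.single (τ t, ρ s) 1 +
      Pi.single (τ t, ρ t) 1 - Pi.single (τ s, τ t) 1 - Pi.single (ρ s, ρ t) 1 - Pi.single (ρ s, ρ s) 1 -
      Pi.single (ρ t, ρ t) 1, fun s t x => ?_⟩
    simp only [add_dotProduct, sub_dotProduct, single_dotProduct, one_mul]
  obtain ⟨c₁, hc₁⟩ : ∃ c₁ : Fin n × Fin n → ℝ, ∀ x, c₁ ⬝ᵥ x = ∑ s, ∑ t, if s = t then (0 : ℝ) else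
      x (τ s, ρ s) + x (τ s, ρ t) + x (τ t, ρ s) + x (τ t, ρ t) - x (τ s, τ t) - x (ρ s, ρ t) -
        x (ρ s, ρ s) - x (ρ t, ρ t) := by
    refine ⟨∑ s, ∑ t, if s = t then 0 else Pv s t, fun x => ?_⟩
    rw [sum_dotProduct]
    refine Finset.sum_congr rfl fun s _ => ?_
    rw [sum_dotProduct]
    refine Finset.sum_congr rfl fun t _ => ?_
    split_ifs
    · exact zero_dotProduct x
    · exact hPv s t x
  -- valid on `COR(K_n)` with maximum `0`
  have hCv : ∀ b : Fin n → Bool, c₁ ⬝ᵥ corVec (⊤ : SimpleGraph (Fin n)) b ≤ 0 := by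
    intro b
    rw [hc₁]
    refine Finset.sum_nonpos fun s _ => Finset.sum_nonpos fun t _ => ?_
    split_ifs
    · exact le_rfl
    · simp only [corVec_top_apply]
      cases b (τ s) <;> cases b (τ t) <;> cases b (ρ s) <;> cases b (ρ t) <;> norm_num
  have hC : ∀ x ∈ corPolytopeGraph (⊤ : SimpleGraph (Fin n)), c₁ ⬝ᵥ x ≤ 0 :=
    dot_le_of_mem_convexHull _ _ _ (by rintro _ ⟨b, rfl⟩; exact hCv b)
  -- vanishes on `W_β`
  have hW : ∀ w ∈ Submodule.span ℝ (Set.range fun b : {b : Fin n → Bool // ∀ p q, β p = β q → b p = b q} =>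
      corVec (⊤ : SimpleGraph (Fin n)) b.1), c₁ ⬝ᵥ w = 0 := by
    intro w hw
    obtain ⟨hws, hwb⟩ := blockConstSym_of_mem_span β hw
    rw [hc₁]
    refine Finset.sum_eq_zero fun s _ => Finset.sum_eq_zero fun t _ => ?_
    split_ifs
    · rfl
    · rw [hwb (τ s) (ρ s) (ρ s) (ρ s) (by rw [hτβ, hρ]) rfl,
        hwb (τ s) (ρ t) (ρ s) (ρ t) (by rw [hτβ, hρ]) rfl,
        hwb (τ t) (ρ s) (ρ t) (ρ s) (by rw [hτβ, hρ]) rfl, hws (ρ t) (ρ s),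
        hwb (τ t) (ρ t) (ρ t) (ρ t) (by rw [hτβ, hρ]) rfl,
        hwb (τ s) (τ t) (ρ s) (ρ t) (by rw [hτβ, hρ]) (by rw [hτβ, hρ])]
      ring
  -- valid on `MET` with maximum `Σ 1/3`, the equality case reads onto one point
  have hMle : ∀ Y ∈ metCor n, ∀ s t, s ≠ t →
      Y (τ s, ρ s) + Y (τ s, ρ t) + Y (τ t, ρ s) + Y (τ t, ρ t) - Y (τ s, τ t) - Y (ρ s, ρ t) -
        Y (ρ s, ρ s) - Y (ρ t, ρ t) ≤ 1 / 3 := fun Y hY s t hst => by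
    obtain ⟨h1, h2, h3, h4⟩ := hne s t hst
    exact pentagonal_le hY (i := τ s) (j := τ t) (k := ρ s) (l := ρ t) h4 (hτne s) h3 h2.symm (hτne t) h1
  have hM : ∀ Y ∈ metCor n, c₁ ⬝ᵥ Y ≤ ∑ s : Fin m, ∑ t : Fin m, (if s = t then (0 : ℝ) else 1 / 3) := by
    intro Y hY
    rw [hc₁]
    refine Finset.sum_le_sum fun s _ => Finset.sum_le_sum fun t _ => ?_
    split_ifs with hst
    · exact le_rfl
    · exact hMle Y hY s t hst
  have hpt : ∀ Y ∈ metCor n, c₁ ⬝ᵥ Y = ∑ s : Fin m, ∑ t : Fin m, (if s = t then (0 : ℝ) else 1 / 3) →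
      ∀ s t, Y (ρ s, ρ t) = if s = t then (1 / 3 : ℝ) else 0 := by
    intro Y hY hface
    rw [hc₁] at hface
    have hle : ∀ s ∈ (Finset.univ : Finset (Fin m)), ∀ t ∈ (Finset.univ : Finset (Fin m)),
        (if s = t then (0 : ℝ) else Y (τ s, ρ s) + Y (τ s, ρ t) + Y (τ t, ρ s) + Y (τ t, ρ t) - Y (τ s, τ t) -
          Y (ρ s, ρ t) - Y (ρ s, ρ s) - Y (ρ t, ρ t)) ≤ (if s = t then (0 : ℝ) else 1 / 3) := by
      intro s _ t _
      split_ifs with hst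
      · exact le_rfl
      · exact hMle Y hY s t hst
    have hrow := (Finset.sum_eq_sum_iff_of_le fun s hs => Finset.sum_le_sum (hle s hs)).1 hface
    have hcell : ∀ s t, s ≠ t → Y (ρ s, ρ s) = 1 / 3 ∧ Y (ρ s, ρ t) = 0 := by
      intro s t hst
      have h := (Finset.sum_eq_sum_iff_of_le (hle s (Finset.mem_univ _))).1 (hrow s (Finset.mem_univ _)) t
        (Finset.mem_univ _)
      rw [if_neg hst, if_neg hst] at h
      obtain ⟨h1, h2, h3, h4⟩ := hne s t hst
      have hq := pentagonal_eq hY (i := τ s) (j := τ t) (k := ρ s) (l := ρ t) h4 (hτne s) h3 h2.symm (hτne t) h1 h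
      exact ⟨hq.2.2.1, hq.2.2.2.2.2.1⟩
    intro s t
    split_ifs with hst
    · subst hst
      obtain ⟨t', ht'⟩ := Fintype.exists_ne_of_one_lt_card (by rw [Fintype.card_fin]; omega) s
      exact (hcell s t' (Ne.symm ht')).1
    · exact (hcell s t hst).2
  -- the anti-cut witness `Y_A = ⅔𝟙 − ⅓δ(leaders)`
  obtain ⟨ℓ, hℓ⟩ : ∃ ℓ : Fin n → Bool, ∀ p, ℓ p = decide (p = ρ (β p)) := ⟨_, fun _ => rfl⟩
  have hℓρ : ∀ s, ℓ (ρ s) = true := fun s => by rw [hℓ, hρ]; simp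
  have hℓτ : ∀ s, ℓ (τ s) = false := fun s => by rw [hℓ, hτβ]; simp [hτne s]
  obtain ⟨YA, hYA⟩ : ∃ YA : Fin n × Fin n → ℝ, ∀ p q, YA (p, q) =
      if p = q then (if ℓ p then 1 / 3 else 2 / 3) else (if ℓ p ∧ ℓ q then 0 else 1 / 3) :=
    ⟨fun pq => if pq.1 = pq.2 then (if ℓ pq.1 then 1 / 3 else 2 / 3) else (if ℓ pq.1 ∧ ℓ pq.2 then 0 else 1 / 3),
      fun _ _ => rfl⟩
  have hYAM : YA ∈ metCor n := by
    refine ⟨⟨fun p q => ?_, fun p => ?_, fun p q hpq => ?_⟩, fun p q r' hpq hqr hpr => ?_⟩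
    · rw [hYA, hYA]
      by_cases h : p = q
      · subst h
        rfl
      · rw [if_neg h, if_neg (Ne.symm h)]
        cases ℓ p <;> cases ℓ q <;> simp
    · rw [hYA, if_pos rfl]
      cases ℓ p <;> simp <;> norm_num
    · rw [hYA p q, hYA p p, hYA q q, if_neg hpq, if_pos rfl, if_pos rfl]
      cases ℓ p <;> cases ℓ q <;> simp <;> norm_num
    · rw [hYA p r', hYA q r', hYA p q, hYA r' r', hYA p p, hYA q q, if_neg hpr, if_neg hqr, if_neg hpq,
        if_pos rfl, if_pos rfl, if_pos rfl]
      cases ℓ p <;> cases ℓ q <;> cases ℓ r' <;> simp <;> norm_num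
  have hYAc : c₁ ⬝ᵥ YA = ∑ s : Fin m, ∑ t : Fin m, (if s = t then (0 : ℝ) else 1 / 3) := by
    rw [hc₁]
    refine Finset.sum_congr rfl fun s _ => Finset.sum_congr rfl fun t _ => ?_
    split_ifs with hst
    · rfl
    · obtain ⟨h1, h2, h3, h4⟩ := hne s t hst
      rw [hYA (τ s) (ρ s), hYA (τ s) (ρ t), hYA (τ t) (ρ s), hYA (τ t) (ρ t), hYA (τ s) (τ t), hYA (ρ s) (ρ t),
        hYA (ρ s) (ρ s), hYA (ρ t) (ρ t), if_neg (hτne s), if_neg h3, if_neg (Ne.symm h2), if_neg (hτne t),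
        if_neg h4, if_neg h1, if_pos rfl, if_pos rfl]
      norm_num [hℓρ, hℓτ]
  have hLYA : LinearMap.funLeft ℝ ℝ (fun ij : Fin m × Fin m => (ρ ij.1, ρ ij.2)) YA =
      fun st => if st.1 = st.2 then (1 / 3 : ℝ) else 0 := by
    funext st
    obtain ⟨s, t⟩ := st
    rw [LinearMap.funLeft_apply]
    show YA (ρ s, ρ t) = if s = t then 1 / 3 else 0
    rw [hYA]
    by_cases hst : s = t
    · subst hst
      simp [hℓρ]
    · rw [if_neg (hne s t hst).1, if_neg hst]
      simp [hℓρ]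
  -- assemble: one cut, read, PROP A with one passenger point
  have h1 := hEF.face_add_face₁ c₁ 0 _ hC hM
  have h2 := h1.image_linearMap (LinearMap.funLeft ℝ ℝ (fun ij : Fin m × Fin m => (ρ ij.1, ρ ij.2)))
  have hG : corPolytopeGraph (⊤ : SimpleGraph (Fin n)) ∩ {x | B ⬝ᵥ x = 0} ⊆
      corPolytopeGraph (⊤ : SimpleGraph (Fin n)) ∩ {x | c₁ ⬝ᵥ x = 0} :=
    fun x hx => ⟨hx.1, dot_eq_zero_on_face β hB hW x hx⟩
  rw [Set.image_add, funLeft_image_of_between β hB hρ hG Set.inter_subset_left] at h2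
  have himg : LinearMap.funLeft ℝ ℝ (fun ij : Fin m × Fin m => (ρ ij.1, ρ ij.2)) ''
      (metCor n ∩ {Y | c₁ ⬝ᵥ Y = ∑ s : Fin m, ∑ t : Fin m, (if s = t then (0 : ℝ) else 1 / 3)}) =
      convexHull ℝ (Set.range fun _ : Fin 1 => (fun st : Fin m × Fin m => if st.1 = st.2 then (1 / 3 : ℝ) else 0)) := by
    rw [Set.range_const, convexHull_singleton]
    apply Set.Subset.antisymm
    · rintro _ ⟨Y, ⟨hY, hface⟩, rfl⟩
      refine Set.mem_singleton_iff.2 (funext fun st => ?_)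
      rw [LinearMap.funLeft_apply]
      exact hpt Y hY hface st.1 st.2
    · intro z hz
      rw [Set.mem_singleton_iff.1 hz]
      exact ⟨YA, ⟨hYAM, hYAc⟩, hLYA⟩
  rw [himg] at h2
  have h4 := corPolytopeGraph_top_add_hull_three_pow_le _ (by norm_num) h2
  simpa using h4

/-! ## §4 For zonotopes the far chambers add nothing: `E♭ = E♯ = ZonoGenBlind` (41 g3)

For `Z = w + Σ_i [0, g_i]` and admissible `c`, `face_c(Z) = w + Σ_{c·g_i>0} g_i + Σ_{c·g_i = 0} [0, g_i]`; an open subset of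
`W_β^⊥` annihilates `g_i` iff `g_i ∈ W_β`.  Hence `E♭(β) ⟺` no generator lies in `W_β ∖ ℝJ` — exactly 41 g3's `ZonoGenBlind`;
the zonotopal enemy spec (E3 / `FewGeneratorZonotopeLaw`) is unchanged, and N14 below adds content only for non-zonotopes. -/

/-- `E♭ = ZonoGenBlind` on zonotopes (kernel food: ⇒ toggle a `W_β`-generator; ⇐ a generic admissible direction,
`DimensionRung40.exists_generic_comb`). -/
def ZonoExposedFibreBlindIff : Prop :=
  ∀ (n m N : ℕ) (β : Fin n → Fin m) (w : Fin n × Fin n → ℝ) (g : Fin N → (Fin n × Fin n → ℝ)),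
    2 ≤ m → Function.Surjective β →
    (ExposedFibreBlind β (fun S : Finset (Fin N) => w + ∑ i ∈ S, g i) ↔
      ∀ i, BlockConstSymGen β (g i) → ∃ α : ℝ, g i = α • Jdir n)

/-- **N14 (necessary condition on the residual enemy):** for EVERY block map with blocks of size ≥ 2 and EVERY admissible
direction — `C₀^β`-perturbative or far (hypermetric, …) — the exposed fibre has a non-`J` edge.  (At
`m = 2(log₂ n + c)^c + 4` blocks this is forced as soon as `r ≤ T c n`.) -/
def ResidualHasFatFibres {J : Type} (n m : ℕ) (q : J → (Fin n × Fin n → ℝ)) : Prop :=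
  ∀ β : Fin n → Fin m, (∀ s, 2 ≤ (univ.filter fun p => β p = s).card) → ¬ ExposedFibreBlind β q

end Summit.ValiantsHypothesis.ValiantsHypothesis.Cruxes.NNDivisionHard.ExposedFibre40

end
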